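import Summits.HodgeConjecture.HodgeConjecture.Theorems.F0P3cStCharTSHleviOfClosedForms   -- ★ p849750 (this seat) `hlevi_of_closed_forms` (the `hOH` binder shape)
import Literature.NumberTheory.Rogawski1990.GRegularLocalisation                          -- ★ `isLocalGRegular_out_mk`; brings ★ `orbitalIntegral_add_localH_of_isLocalGRegular`
import Literature.NumberTheory.Rogawski1990.LocalTransferGlue                             -- ★ `IsLocSmooth.add`
import HarnessLib

/-!
# F0 · P3c · line LH6 «StCharTS» — road (D) «DEEP-FL», (D-c) kit A «HOH OF SUMMANDS»: the canonical `H`-orbital integral is linear on `C_c^∞(H_v)` at `G`-regular classes,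
# so the closed-form hypothesis `hOH` of ★ `hlevi_of_closed_forms` for the refined test function `f^H₀ = Σ_j c_j • g_j` follows from the per-summand closed forms

Cell `pub/hodgecm-mathlib`, crux H413 = `stmt-HodgeConjecture-24833` (lane `--supports … --as helper`), route HCCMUnconditional; seat LH6-p04 (g3); road owner of record LH6-p03 (g0),
ROAD-D status v5 `F0/P3b/LH6-p03/g0/ROAD-D.status.v5.txt` CHANGE 1 (`f^H₀ := Σ_{j∈F} c_j • 𝟙_{K_{H,n′} u_j K_{H,n′}}`).  THEOREMS ONLY, sorry-free, ★-only imports; no definition ∕ instance ∕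
notation ∕ named fact.  HONEST LABEL: HC_CM is proved only modulo the 7 printed citations (2 remaining: hLiu418 = stmt-HodgeConjecture-24832, h413 = stmt-HodgeConjecture-24833) until
rung 0 closes; count-neutral plumbing of road (D).

THE MATHEMATICS ([Rogawski1990, §4.3 (4.3.1) p. 43; §4.9 p. 54; §12.7 L. 12.7.3 (proof) p. 195]).  At a `G`-regular `γ_H ∈ H_v = U(Φ₂)_v × U(Φ₁)_v` the conjugacy class is closed, so
for a family `m_H` admissible on the `G`-regular classes (★ `OrbitalMeasureFamily.IsAdmissibleOn (IsLocalGRegular L v)` — e.g. Rogawski's canonical family, ★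
`IsCanonical.isAdmissibleOn`) the orbital integral `Φ([γ_H], ·)` is additive on `C_c(H_v)` (★ `orbitalIntegral_add_localH_of_isLocalGRegular`) and homogeneous (★ `orbitalIntegral_smul`);
§1 records the `C_c^∞` finite-sum forms (the `H` twin of ★ `classOrbitalIntegral_finset_sum_of_isLocSmooth`).  §2: consequently, if every summand `g_j` has its canonical orbital
integral at the hyperbolic diagonal-Levi points in the D3-ii-H closed form `δ_{B₂}^{1∕2}(t_H)⁻¹ · W_H(t_H) · Φ_j(t_H, u)` (the `hOH` shape of ★ `hlevi_of_closed_forms`, per summand: ★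
`F0P3cStCharTSShellOrbitalH.classOrbitalIntegralH_eq_twoCoset_apply` ∕ ★ `F0P3cStCharTSNormalizedOrbitalH`), then `f^H₀ = Σ_{j∈s} c_j • g_j` has it with the step function
`Φ_H := Σ_{j∈s} c_j · Φ_j` — the `hOH` binder of ★ `hlevi_of_closed_forms` VERBATIM.

* §1 `classOrbitalIntegralH_add_of_isLocSmooth`, `classOrbitalIntegralH_smul`, `isLocSmooth_smul`, `isLocSmooth_finset_sum_smul`, `classOrbitalIntegralH_finset_sum_of_isLocSmooth`,
  **`classOrbitalIntegralH_finset_sum_smul_of_isLocSmooth`**.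
* §2 **`hOH_of_summands`**.

## References
* [Rogawski1990] J. D. Rogawski, *Automorphic Representations of Unitary Groups in Three Variables*, Ann. of Math. Stud. 123 (1990): §4.3 (4.3.1) p. 43; §4.9 p. 54, (4.9.4)
  p. 56; §12.7 Lemma 12.7.3 (proof) p. 195.
* [GetzHahn2024] J. Getz, H. Hahn, *An Introduction to Automorphic Representations*, GTM 300 (2024), §17.3.
-/

set_option autoImplicit false
-- the mandated namespace has the single-problem summit's repeated segment (`HodgeConjecture.HodgeConjecture`)
set_option linter.dupNamespace false

noncomputable section

open MeasureTheory Matrix NumberField IsDedekindDomain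
open scoped NNReal MatrixGroups
open Literature.NumberTheory.Rogawski1990 Literature.NumberTheory.Automorphic Literature.NumberTheory.Automorphic.UnitaryGroup
open Literature.NumberTheory.GaloisRepresentations

namespace Summit.HodgeConjecture.HodgeConjecture.Cruxes.H413.F0P3cStCharTSHleviSummands

variable (L : Type) [Field L] [NumberField L] [IsCMField L] (v : HeightOneSpectrum (𝓞 ↥(maximalRealSubfield L)))

/-! ## §1 Linearity of the canonical `H`-orbital integral on `C_c^∞(H_v)` at `G`-regular classes -/

section Linear

variable
  [∀ aH : ((cmDatum L 2 (Matrix.of fun i j : Fin 2 => if i.val + j.val + 1 = 2 then (1 : L) else 0)).Local v × (cmDatum L 1 (Matrix.of fun i j : Fin 1 => if i.val + j.val + 1 = 1 then (1 : L) else 0)).Local v),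
    MeasurableSpace (((cmDatum L 2 (Matrix.of fun i j : Fin 2 => if i.val + j.val + 1 = 2 then (1 : L) else 0)).Local v × (cmDatum L 1 (Matrix.of fun i j : Fin 1 => if i.val + j.val + 1 = 1 then (1 : L) else 0)).Local v) ⧸
      Subgroup.centralizer ({aH} : Set ((cmDatum L 2 (Matrix.of fun i j : Fin 2 => if i.val + j.val + 1 = 2 then (1 : L) else 0)).Local v × (cmDatum L 1 (Matrix.of fun i j : Fin 1 => if i.val + j.val + 1 = 1 then (1 : L) else 0)).Local v)))]
  [∀ aH : ((cmDatum L 2 (Matrix.of fun i j : Fin 2 => if i.val + j.val + 1 = 2 then (1 : L) else 0)).Local v × (cmDatum L 1 (Matrix.of fun i j : Fin 1 => if i.val + j.val + 1 = 1 then (1 : L) else 0)).Local v),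
    BorelSpace (((cmDatum L 2 (Matrix.of fun i j : Fin 2 => if i.val + j.val + 1 = 2 then (1 : L) else 0)).Local v × (cmDatum L 1 (Matrix.of fun i j : Fin 1 => if i.val + j.val + 1 = 1 then (1 : L) else 0)).Local v) ⧸
      Subgroup.centralizer ({aH} : Set ((cmDatum L 2 (Matrix.of fun i j : Fin 2 => if i.val + j.val + 1 = 2 then (1 : L) else 0)).Local v × (cmDatum L 1 (Matrix.of fun i j : Fin 1 => if i.val + j.val + 1 = 1 then (1 : L) else 0)).Local v)))]
  {mH : OrbitalMeasureFamily ((cmDatum L 2 (Matrix.of fun i j : Fin 2 => if i.val + j.val + 1 = 2 then (1 : L) else 0)).Local v ×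
    (cmDatum L 1 (Matrix.of fun i j : Fin 1 => if i.val + j.val + 1 = 1 then (1 : L) else 0)).Local v)}

/-- **Additivity at a `G`-regular class**: `Φ(c, F + G) = Φ(c, F) + Φ(c, G)` for `F, G ∈ C_c^∞(H_v)` and `m_H` admissible on the `G`-regular classes (the class of `out c` is
closed: ★ `orbitalIntegral_add_localH_of_isLocalGRegular`). [cite: Rogawski1990, §4.3 (4.3.1) p. 43; §4.9 p. 54] -/
theorem classOrbitalIntegralH_add_of_isLocSmooth (hmH : mH.IsAdmissibleOn (IsLocalGRegular L v))
    (c : ConjClasses ((cmDatum L 2 (Matrix.of fun i j : Fin 2 => if i.val + j.val + 1 = 2 then (1 : L) else 0)).Local v ×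
      (cmDatum L 1 (Matrix.of fun i j : Fin 1 => if i.val + j.val + 1 = 1 then (1 : L) else 0)).Local v)) (hc : IsLocalGRegular L v (Quotient.out c))
    (F G : ((cmDatum L 2 (Matrix.of fun i j : Fin 2 => if i.val + j.val + 1 = 2 then (1 : L) else 0)).Local v ×
      (cmDatum L 1 (Matrix.of fun i j : Fin 1 => if i.val + j.val + 1 = 1 then (1 : L) else 0)).Local v) → ℂ) (hF : IsLocSmooth F) (hG : IsLocSmooth G) :
    classOrbitalIntegral mH (F + G) c = classOrbitalIntegral mH F c + classOrbitalIntegral mH G c := by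
  haveI := hmH.isFiniteMeasureOnCompacts hc
  simp only [classOrbitalIntegral_eq]
  exact orbitalIntegral_add_localH_of_isLocalGRegular L v (Quotient.out c) hc (mH c) hF.1.continuous hF.2 hG.1.continuous hG.2

omit [∀ aH : ((cmDatum L 2 (Matrix.of fun i j : Fin 2 => if i.val + j.val + 1 = 2 then (1 : L) else 0)).Local v × (cmDatum L 1 (Matrix.of fun i j : Fin 1 => if i.val + j.val + 1 = 1 then (1 : L) else 0)).Local v),
    BorelSpace (((cmDatum L 2 (Matrix.of fun i j : Fin 2 => if i.val + j.val + 1 = 2 then (1 : L) else 0)).Local v × (cmDatum L 1 (Matrix.of fun i j : Fin 1 => if i.val + j.val + 1 = 1 then (1 : L) else 0)).Local v) ⧸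
      Subgroup.centralizer ({aH} : Set ((cmDatum L 2 (Matrix.of fun i j : Fin 2 => if i.val + j.val + 1 = 2 then (1 : L) else 0)).Local v × (cmDatum L 1 (Matrix.of fun i j : Fin 1 => if i.val + j.val + 1 = 1 then (1 : L) else 0)).Local v)))] in
/-- **Homogeneity**: `Φ(c, z • F) = z · Φ(c, F)` (any class, any family; ★ `orbitalIntegral_smul`). [cite: Rogawski1990, §4.9 p. 54] -/
theorem classOrbitalIntegralH_smul
    (c : ConjClasses ((cmDatum L 2 (Matrix.of fun i j : Fin 2 => if i.val + j.val + 1 = 2 then (1 : L) else 0)).Local v ×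
      (cmDatum L 1 (Matrix.of fun i j : Fin 1 => if i.val + j.val + 1 = 1 then (1 : L) else 0)).Local v)) (z : ℂ)
    (F : ((cmDatum L 2 (Matrix.of fun i j : Fin 2 => if i.val + j.val + 1 = 2 then (1 : L) else 0)).Local v ×
      (cmDatum L 1 (Matrix.of fun i j : Fin 1 => if i.val + j.val + 1 = 1 then (1 : L) else 0)).Local v) → ℂ) :
    classOrbitalIntegral mH (z • F) c = z * classOrbitalIntegral mH F c := by
  simp only [classOrbitalIntegral_eq]
  rw [orbitalIntegral_smul, smul_eq_mul]

omit [IsCMField L] in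
/-- `z • F ∈ C_c^∞` for `F ∈ C_c^∞`. [cite: Rogawski1990, §1.6 p. 6] -/
theorem isLocSmooth_smul {X : Type*} [TopologicalSpace X] (z : ℂ) {F : X → ℂ} (hF : IsLocSmooth F) : IsLocSmooth (z • F) :=
  ⟨by
    have h : IsLocallyConstant ((fun y : ℂ => z * y) ∘ F) := hF.1.comp fun y : ℂ => z * y
    exact h, hF.2.smul_left (f := fun _ => z)⟩

omit [IsCMField L] in
/-- `Σ_{j∈s} c_j • g_j ∈ C_c^∞` for `g_j ∈ C_c^∞`. [cite: Rogawski1990, §1.6 p. 6] -/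
theorem isLocSmooth_finset_sum_smul {X : Type*} [TopologicalSpace X] {ι : Type*} (s : Finset ι) (cj : ι → ℂ) (g : ι → X → ℂ)
    (hg : ∀ j ∈ s, IsLocSmooth (g j)) : IsLocSmooth (∑ j ∈ s, cj j • g j) := by
  classical
  induction s using Finset.induction_on with
  | empty => rw [Finset.sum_empty]; exact isLocSmooth_zero
  | insert i s hi ih =>
    rw [Finset.sum_insert hi]
    exact (isLocSmooth_smul (cj i) (hg i (Finset.mem_insert_self i s))).add (ih fun j hj => hg j (Finset.mem_insert_of_mem hj))

/-- **`Φ(c, Σ_{j∈s} g_j) = Σ_{j∈s} Φ(c, g_j)`** at a `G`-regular class for `g_j ∈ C_c^∞(H_v)`, `m_H` admissible on the `G`-regular classes (the `H` twin of ★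
`classOrbitalIntegral_finset_sum_of_isLocSmooth`). [cite: Rogawski1990, §4.3 (4.3.1) p. 43; §4.9 p. 54] -/
theorem classOrbitalIntegralH_finset_sum_of_isLocSmooth (hmH : mH.IsAdmissibleOn (IsLocalGRegular L v))
    (c : ConjClasses ((cmDatum L 2 (Matrix.of fun i j : Fin 2 => if i.val + j.val + 1 = 2 then (1 : L) else 0)).Local v ×
      (cmDatum L 1 (Matrix.of fun i j : Fin 1 => if i.val + j.val + 1 = 1 then (1 : L) else 0)).Local v)) (hc : IsLocalGRegular L v (Quotient.out c))
    {ι : Type*} (s : Finset ι)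
    (g : ι → ((cmDatum L 2 (Matrix.of fun i j : Fin 2 => if i.val + j.val + 1 = 2 then (1 : L) else 0)).Local v ×
      (cmDatum L 1 (Matrix.of fun i j : Fin 1 => if i.val + j.val + 1 = 1 then (1 : L) else 0)).Local v) → ℂ) (hg : ∀ j ∈ s, IsLocSmooth (g j)) :
    classOrbitalIntegral mH (∑ j ∈ s, g j) c = ∑ j ∈ s, classOrbitalIntegral mH (g j) c := by
  classical
  induction s using Finset.induction_on with
  | empty =>
    simp only [Finset.sum_empty, classOrbitalIntegral_eq]
    exact orbitalIntegral_zero_fun _ _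
  | insert i s hi ih =>
    have hs : IsLocSmooth (∑ j ∈ s, g j) := by
      have h := isLocSmooth_finset_sum_smul s (fun _ => (1 : ℂ)) g fun j hj => hg j (Finset.mem_insert_of_mem hj)
      simp only [one_smul] at h
      exact h
    rw [Finset.sum_insert hi, Finset.sum_insert hi,
      classOrbitalIntegralH_add_of_isLocSmooth L v hmH c hc (g i) (∑ j ∈ s, g j) (hg i (Finset.mem_insert_self i s)) hs,
      ih fun j hj => hg j (Finset.mem_insert_of_mem hj)]

/-- **`Φ(c, Σ_{j∈s} c_j • g_j) = Σ_{j∈s} c_j · Φ(c, g_j)`** at a `G`-regular class for `g_j ∈ C_c^∞(H_v)`, `m_H` admissible on the `G`-regular classes — the orbital side of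
ROAD-D v5 CHANGE 1 for `f^H₀ = Σ_j c_j • 𝟙_{K_H u_j K_H}`. [cite: Rogawski1990, §4.3 (4.3.1) p. 43; §4.9 p. 54; §12.7 Lemma 12.7.3 (proof) p. 195] -/
theorem classOrbitalIntegralH_finset_sum_smul_of_isLocSmooth (hmH : mH.IsAdmissibleOn (IsLocalGRegular L v))
    (c : ConjClasses ((cmDatum L 2 (Matrix.of fun i j : Fin 2 => if i.val + j.val + 1 = 2 then (1 : L) else 0)).Local v ×
      (cmDatum L 1 (Matrix.of fun i j : Fin 1 => if i.val + j.val + 1 = 1 then (1 : L) else 0)).Local v)) (hc : IsLocalGRegular L v (Quotient.out c))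
    {ι : Type*} (s : Finset ι) (cj : ι → ℂ)
    (g : ι → ((cmDatum L 2 (Matrix.of fun i j : Fin 2 => if i.val + j.val + 1 = 2 then (1 : L) else 0)).Local v ×
      (cmDatum L 1 (Matrix.of fun i j : Fin 1 => if i.val + j.val + 1 = 1 then (1 : L) else 0)).Local v) → ℂ) (hg : ∀ j ∈ s, IsLocSmooth (g j)) :
    classOrbitalIntegral mH (∑ j ∈ s, cj j • g j) c = ∑ j ∈ s, cj j * classOrbitalIntegral mH (g j) c := by
  rw [classOrbitalIntegralH_finset_sum_of_isLocSmooth L v hmH c hc s (fun j => cj j • g j) fun j hj => isLocSmooth_smul (cj j) (hg j hj)]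
  exact Finset.sum_congr rfl fun j _ => classOrbitalIntegralH_smul L v c (cj j) (g j)

end Linear

/-! ## §2 `hOH` for `f^H₀ = Σ_j c_j • g_j` from the per-summand closed forms -/

open scoped Classical in
set_option maxHeartbeats 3200000 in  -- statement-level `whnf` on the CM carriers and the modulus tokens of ★ D3-ii-H
set_option synthInstance.maxHeartbeats 400000 in
/-- **(D-c) kit A «HOH OF SUMMANDS».**  For `m_H` admissible on the `G`-regular classes, `g_j ∈ C_c^∞(H_v)` (`j ∈ s`), coefficients `c_j`, and step functions
`Φ_j : T₂ × U(Φ₁)_v → ℂ`: if each `g_j` satisfies the `hOH` clause of ★ `hlevi_of_closed_forms` with `Φ_j` (at every hyperbolic `G`-regular diagonal-Levi point, in the token shape of ★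
`classOrbitalIntegralH_eq_twoCoset_apply`), then `f^H₀ := Σ_{j∈s} c_j • g_j` satisfies it with `Φ_H := fun x => Σ_{j∈s} c_j · Φ_j x` (§1 linearity at the class `[γ_H]`, `G`-regular by ★
`isLocalGRegular_out_mk`). [cite: Rogawski1990, §4.9 (4.9.4) p. 56; §4.3 (4.3.1) p. 43; §12.7 Lemma 12.7.3 (proof) p. 195] -/
theorem hOH_of_summands
    [∀ aH : ((cmDatum L 2 (Matrix.of fun i j : Fin 2 => if i.val + j.val + 1 = 2 then (1 : L) else 0)).Local v × (cmDatum L 1 (Matrix.of fun i j : Fin 1 => if i.val + j.val + 1 = 1 then (1 : L) else 0)).Local v),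
      MeasurableSpace (((cmDatum L 2 (Matrix.of fun i j : Fin 2 => if i.val + j.val + 1 = 2 then (1 : L) else 0)).Local v × (cmDatum L 1 (Matrix.of fun i j : Fin 1 => if i.val + j.val + 1 = 1 then (1 : L) else 0)).Local v) ⧸
        Subgroup.centralizer ({aH} : Set ((cmDatum L 2 (Matrix.of fun i j : Fin 2 => if i.val + j.val + 1 = 2 then (1 : L) else 0)).Local v × (cmDatum L 1 (Matrix.of fun i j : Fin 1 => if i.val + j.val + 1 = 1 then (1 : L) else 0)).Local v)))]
    [∀ aH : ((cmDatum L 2 (Matrix.of fun i j : Fin 2 => if i.val + j.val + 1 = 2 then (1 : L) else 0)).Local v × (cmDatum L 1 (Matrix.of fun i j : Fin 1 => if i.val + j.val + 1 = 1 then (1 : L) else 0)).Local v),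
      BorelSpace (((cmDatum L 2 (Matrix.of fun i j : Fin 2 => if i.val + j.val + 1 = 2 then (1 : L) else 0)).Local v × (cmDatum L 1 (Matrix.of fun i j : Fin 1 => if i.val + j.val + 1 = 1 then (1 : L) else 0)).Local v) ⧸
        Subgroup.centralizer ({aH} : Set ((cmDatum L 2 (Matrix.of fun i j : Fin 2 => if i.val + j.val + 1 = 2 then (1 : L) else 0)).Local v × (cmDatum L 1 (Matrix.of fun i j : Fin 1 => if i.val + j.val + 1 = 1 then (1 : L) else 0)).Local v)))]
    (w : PlacesOver L v) (hw : IsCMField.complexConj L • w.1 = w.1)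
    {mH : OrbitalMeasureFamily ((cmDatum L 2 (Matrix.of fun i j : Fin 2 => if i.val + j.val + 1 = 2 then (1 : L) else 0)).Local v ×
      (cmDatum L 1 (Matrix.of fun i j : Fin 1 => if i.val + j.val + 1 = 1 then (1 : L) else 0)).Local v)}
    (hmH : mH.IsAdmissibleOn (IsLocalGRegular L v))
    {ι : Type*} (s : Finset ι) (cj : ι → ℂ)
    (g : ι → ((cmDatum L 2 (Matrix.of fun i j : Fin 2 => if i.val + j.val + 1 = 2 then (1 : L) else 0)).Local v ×
      (cmDatum L 1 (Matrix.of fun i j : Fin 1 => if i.val + j.val + 1 = 1 then (1 : L) else 0)).Local v) → ℂ) (hg : ∀ j ∈ s, IsLocSmooth (g j))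
    (Φ : ι → ↥(cmBorelTriple L 2 v).M × (cmDatum L 1 (Matrix.of fun i j : Fin 1 => if i.val + j.val + 1 = 1 then (1 : L) else 0)).Local v → ℂ)
    (hOHj : ∀ j ∈ s, ∀ (γH : ((cmDatum L 2 (Matrix.of fun i j : Fin 2 => if i.val + j.val + 1 = 2 then (1 : L) else 0)).Local v × (cmDatum L 1 (Matrix.of fun i j : Fin 1 => if i.val + j.val + 1 = 1 then (1 : L) else 0)).Local v))
      (d' : Fin 2 → (LocalRing L v)ˣ), glDiagonal 2 (LocalRing L v) d' = ((γH.1).val : GL (Fin 2) (LocalRing L v)) → IsLocalGRegular L v γH →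
      Valued.v (((d' 1 : (LocalRing L v)ˣ) : LocalRing L v) w) < Valued.v (((d' 0 : (LocalRing L v)ˣ) : LocalRing L v) w) →
      galAdicCompletionMap (L := L) (IsCMField.complexConj L) hw (((d' 0 : (LocalRing L v)ˣ) : LocalRing L v) w) * ((d' 1 : (LocalRing L v)ˣ) : LocalRing L v) w = 1 →
      ∀ (tH : ↥(cmBorelTriple L 2 v).M), (tH : ↥(unitaryGroupOfForm (conjLocal L (IsCMField.complexConj L) v) (cmLocalForm L 2 v))) = γH.1 →
      ∀ (hdH : glDiagonal 2 (LocalRing L v) d' = ((tH : ↥(unitaryGroupOfForm (conjLocal L (IsCMField.complexConj L) v) (cmLocalForm L 2 v))) : GL (Fin 2) (LocalRing L v)))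
        (hb : IsUnit ((((d' 0)⁻¹ * d' 1 : (LocalRing L v)ˣ) : LocalRing L v) - 1)),
      haveI := locallyCompactSpace_cmBorelU L 2 v
      classOrbitalIntegral mH (g j) (ConjClasses.mk (((tH : ↥(unitaryGroupOfForm (conjLocal L (IsCMField.complexConj L) v) (cmLocalForm L 2 v))) :
          ((cmDatum L 2 (Matrix.of fun i j : Fin 2 => if i.val + j.val + 1 = 2 then (1 : L) else 0)).Local v)), γH.2)) =
        ((rootDeltaChar (cmBorelTriple L 2 v).P ⟨(tH : ↥(unitaryGroupOfForm (conjLocal L (IsCMField.complexConj L) v) (cmLocalForm L 2 v))), (cmBorelTriple L 2 v).M_le tH.2⟩ : ℂˣ) : ℂ)⁻¹ *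
          (((letI : MeasurableSpace (LocalRing L v) := borel _; haveI : BorelSpace (LocalRing L v) := ⟨rfl⟩
            haveI : SecondCountableTopology (LocalRing L v) := secondCountableTopology_localRing (E := L) v
            ((HeisRing.skewModulus (conjLocal L (IsCMField.complexConj L) v) (continuous_conjLocal L (IsCMField.complexConj L) v) hb.unit
              (LineRing.map_unit_torusScalar_sub_one_two (conjLocal L (IsCMField.complexConj L) v) (cmLocalForm_eq_over L 2 v)
                (⟨(tH : ↥(unitaryGroupOfForm (conjLocal L (IsCMField.complexConj L) v) (cmLocalForm L 2 v))), tH.2⟩ :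
                  ↥(torusU (conjLocal L (IsCMField.complexConj L) v) (cmLocalForm L 2 v))) hdH hb))⁻¹ : ℝ≥0)) : ℝ) : ℂ) *
          Φ j (tH, γH.2))
    -- the `hOH` binders of ★ `hlevi_of_closed_forms`
    (γH : ((cmDatum L 2 (Matrix.of fun i j : Fin 2 => if i.val + j.val + 1 = 2 then (1 : L) else 0)).Local v × (cmDatum L 1 (Matrix.of fun i j : Fin 1 => if i.val + j.val + 1 = 1 then (1 : L) else 0)).Local v))
    (d' : Fin 2 → (LocalRing L v)ˣ) (hd' : glDiagonal 2 (LocalRing L v) d' = ((γH.1).val : GL (Fin 2) (LocalRing L v))) (hreg : IsLocalGRegular L v γH)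
    (hlt : Valued.v (((d' 1 : (LocalRing L v)ˣ) : LocalRing L v) w) < Valued.v (((d' 0 : (LocalRing L v)ˣ) : LocalRing L v) w))
    (h01 : galAdicCompletionMap (L := L) (IsCMField.complexConj L) hw (((d' 0 : (LocalRing L v)ˣ) : LocalRing L v) w) * ((d' 1 : (LocalRing L v)ˣ) : LocalRing L v) w = 1)
    (tH : ↥(cmBorelTriple L 2 v).M) (htH : (tH : ↥(unitaryGroupOfForm (conjLocal L (IsCMField.complexConj L) v) (cmLocalForm L 2 v))) = γH.1)
    (hdH : glDiagonal 2 (LocalRing L v) d' = ((tH : ↥(unitaryGroupOfForm (conjLocal L (IsCMField.complexConj L) v) (cmLocalForm L 2 v))) : GL (Fin 2) (LocalRing L v)))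
    (hb : IsUnit ((((d' 0)⁻¹ * d' 1 : (LocalRing L v)ˣ) : LocalRing L v) - 1)) :
    haveI := locallyCompactSpace_cmBorelU L 2 v
    classOrbitalIntegral mH (∑ j ∈ s, cj j • g j) (ConjClasses.mk (((tH : ↥(unitaryGroupOfForm (conjLocal L (IsCMField.complexConj L) v) (cmLocalForm L 2 v))) :
        ((cmDatum L 2 (Matrix.of fun i j : Fin 2 => if i.val + j.val + 1 = 2 then (1 : L) else 0)).Local v)), γH.2)) =
      ((rootDeltaChar (cmBorelTriple L 2 v).P ⟨(tH : ↥(unitaryGroupOfForm (conjLocal L (IsCMField.complexConj L) v) (cmLocalForm L 2 v))), (cmBorelTriple L 2 v).M_le tH.2⟩ : ℂˣ) : ℂ)⁻¹ *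
        (((letI : MeasurableSpace (LocalRing L v) := borel _; haveI : BorelSpace (LocalRing L v) := ⟨rfl⟩
          haveI : SecondCountableTopology (LocalRing L v) := secondCountableTopology_localRing (E := L) v
          ((HeisRing.skewModulus (conjLocal L (IsCMField.complexConj L) v) (continuous_conjLocal L (IsCMField.complexConj L) v) hb.unit
            (LineRing.map_unit_torusScalar_sub_one_two (conjLocal L (IsCMField.complexConj L) v) (cmLocalForm_eq_over L 2 v)
              (⟨(tH : ↥(unitaryGroupOfForm (conjLocal L (IsCMField.complexConj L) v) (cmLocalForm L 2 v))), tH.2⟩ :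
                ↥(torusU (conjLocal L (IsCMField.complexConj L) v) (cmLocalForm L 2 v))) hdH hb))⁻¹ : ℝ≥0)) : ℝ) : ℂ) *
        (fun x : ↥(cmBorelTriple L 2 v).M × (cmDatum L 1 (Matrix.of fun i j : Fin 1 => if i.val + j.val + 1 = 1 then (1 : L) else 0)).Local v => ∑ j ∈ s, cj j * Φ j x) (tH, γH.2) := by
  haveI := locallyCompactSpace_cmBorelU L 2 v
  -- the class `[(t_H, u)] = [γ_H]` is `G`-regular
  have hγ : ((((tH : ↥(unitaryGroupOfForm (conjLocal L (IsCMField.complexConj L) v) (cmLocalForm L 2 v))) :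
      ((cmDatum L 2 (Matrix.of fun i j : Fin 2 => if i.val + j.val + 1 = 2 then (1 : L) else 0)).Local v)), γH.2) :
      ((cmDatum L 2 (Matrix.of fun i j : Fin 2 => if i.val + j.val + 1 = 2 then (1 : L) else 0)).Local v × (cmDatum L 1 (Matrix.of fun i j : Fin 1 => if i.val + j.val + 1 = 1 then (1 : L) else 0)).Local v)) = γH :=
    Prod.ext htH rfl
  have hc : IsLocalGRegular L v (Quotient.out (ConjClasses.mk (((tH : ↥(unitaryGroupOfForm (conjLocal L (IsCMField.complexConj L) v) (cmLocalForm L 2 v))) :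
      ((cmDatum L 2 (Matrix.of fun i j : Fin 2 => if i.val + j.val + 1 = 2 then (1 : L) else 0)).Local v)), γH.2))) := by
    rw [hγ]; exact isLocalGRegular_out_mk hreg
  rw [classOrbitalIntegralH_finset_sum_smul_of_isLocSmooth L v hmH _ hc s cj g hg]
  -- summand by summand
  set δ₂ : ℂ := ((rootDeltaChar (cmBorelTriple L 2 v).P
        ⟨(tH : ↥(unitaryGroupOfForm (conjLocal L (IsCMField.complexConj L) v) (cmLocalForm L 2 v))), (cmBorelTriple L 2 v).M_le tH.2⟩ : ℂˣ) : ℂ) with hδ₂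
  set WH : ℂ := (((letI : MeasurableSpace (LocalRing L v) := borel _; haveI : BorelSpace (LocalRing L v) := ⟨rfl⟩
          haveI : SecondCountableTopology (LocalRing L v) := secondCountableTopology_localRing (E := L) v
          ((HeisRing.skewModulus (conjLocal L (IsCMField.complexConj L) v) (continuous_conjLocal L (IsCMField.complexConj L) v) hb.unit
            (LineRing.map_unit_torusScalar_sub_one_two (conjLocal L (IsCMField.complexConj L) v) (cmLocalForm_eq_over L 2 v)
              (⟨(tH : ↥(unitaryGroupOfForm (conjLocal L (IsCMField.complexConj L) v) (cmLocalForm L 2 v))), tH.2⟩ :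
                ↥(torusU (conjLocal L (IsCMField.complexConj L) v) (cmLocalForm L 2 v))) hdH hb))⁻¹ : ℝ≥0)) : ℝ) : ℂ) with hWH
  have hsum : ∑ j ∈ s, cj j * classOrbitalIntegral mH (g j) (ConjClasses.mk (((tH : ↥(unitaryGroupOfForm (conjLocal L (IsCMField.complexConj L) v) (cmLocalForm L 2 v))) :
      ((cmDatum L 2 (Matrix.of fun i j : Fin 2 => if i.val + j.val + 1 = 2 then (1 : L) else 0)).Local v)), γH.2)) = ∑ j ∈ s, cj j * (δ₂⁻¹ * WH * Φ j (tH, γH.2)) :=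
    Finset.sum_congr rfl fun j hj => by rw [hOHj j hj γH d' hd' hreg hlt h01 tH htH hdH hb]
  rw [hsum, Finset.mul_sum]
  exact Finset.sum_congr rfl fun j _ => by ring

end Summit.HodgeConjecture.HodgeConjecture.Cruxes.H413.F0P3cStCharTSHleviSummands

end
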